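import Summits.ValiantsHypothesis.ValiantsHypothesis.Theorems.BarrierLeverAnchoredDoorHitsLowerPairsDefs

/-!
# Route BarrierLever — item `AnchoredDoorHitsLowerPairs` (stmt-ValiantsHypothesis-22510), line `anchored-peeling`:
# MONOTONICITY OF THE SYMBOLIC MINOR IN THE PROFILE BOUND `s`

Prover file (cell valiant-natproofs, rung V4, 𝒟-side; seat val-np-p2 gen 10, `--supports stmt-ValiantsHypothesis-22510`).

`symbolicDet s h r u w ≠ 0 → symbolicDet s' h r u w ≠ 0` for `s ≤ s'`: killing the weights `θ_α` of the anchors of profile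
in `(s, s']` is a ring endomorphism `κ_s` of the parameter ring with `κ_s (symbolicDet s' …) = symbolicDet s …`.  So every
non-vanishing statement proved (or certified) for the small door 𝔄_s transfers to every 𝔄_{s'}, `s' ≥ s`; in particular
the line may take its hit property from 𝔄₁ (vertex | vertex anchors only) wherever that is available — the census of
HOME/val-np-p2/g10/CENSUS-A1-valnp2-g10.md (≈ 42 000 lower pairs, all alive for 𝔄₁) is stated for `s = 1` and applies to
all `s` by `symbolicDet_ne_zero_mono`; `stub_symbolicNonvanishing_of_profile` records the consequence for the line's stub.
Definition-free (the substitution is written inline as `bind₁ (Sum.elim …)`).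

WHAT THIS IS NOT: no non-vanishing is proved here; nothing on crux stmt-ValiantsHypothesis-14610 or `VP` versus `VNP`.
-/

set_option linter.dupNamespace false

namespace Summit.ValiantsHypothesis.ValiantsHypothesis.Theorems.BarrierLever.AnchoredPeeling

open Finset MvPolynomial

noncomputable section

variable {h : ℕ}

/-- The anchors of profile `≤ s` are among those of profile `≤ s'` when `s ≤ s'`. -/
theorem anchors_mono {s s' : ℕ} (hss : s ≤ s') : anchors s h ⊆ anchors s' h := by
  intro α hα
  simp only [anchors, mem_filter, mem_univ, true_and] at hα ⊢
  exact ⟨hα.1, hα.2.1.trans hss, hα.2.2.1, hα.2.2.2.trans hss⟩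

/-- The `θ`-killing substitution `κ_s` (weights of anchors outside `anchors s h` ↦ 0, everything else kept) maps the
symbolic witness of profile `s'` to the one of profile `s` (`s ≤ s'`): the killed factors become `1`. -/
theorem map_kill_symbolicWitness {s s' : ℕ} (hss : s ≤ s') :
    MvPolynomial.map (bind₁ (Sum.elim (fun α => if α ∈ anchors s h then X (Sum.inl α) else 0)
        (fun q => X (Sum.inr q)) : Param h → MvPolynomial (Param h) ℂ)).toRingHom
      (symbolicWitness s' h) = symbolicWitness s h := by
  unfold symbolicWitness
  rw [map_prod]
  have key : ∀ α ∈ anchors s' h,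
      MvPolynomial.map (bind₁ (Sum.elim (fun α => if α ∈ anchors s h then X (Sum.inl α) else 0)
        (fun q => X (Sum.inr q)) : Param h → MvPolynomial (Param h) ℂ)).toRingHom
        ((1 + C (X (Sum.inl α)) * (∏ a ∈ α.1, X (Fin.castAdd h a)) * (∏ c ∈ α.2, X (Fin.natAdd h c)) *
          (∏ b ∈ univ \ α.1, (1 + C (X (Sum.inr (Sum.inl (α, b)))) * X (Fin.castAdd h b))) *
          (∏ d ∈ univ \ α.2, (1 + C (X (Sum.inr (Sum.inr (α, d)))) * X (Fin.natAdd h d)))) :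
          MvPolynomial (Fin (h + h)) (MvPolynomial (Param h) ℂ)) =
      if α ∈ anchors s h then
        (1 + C (X (Sum.inl α)) * (∏ a ∈ α.1, X (Fin.castAdd h a)) * (∏ c ∈ α.2, X (Fin.natAdd h c)) *
          (∏ b ∈ univ \ α.1, (1 + C (X (Sum.inr (Sum.inl (α, b)))) * X (Fin.castAdd h b))) *
          (∏ d ∈ univ \ α.2, (1 + C (X (Sum.inr (Sum.inr (α, d)))) * X (Fin.natAdd h d))))
      else 1 := by
    intro α _
    by_cases hα : α ∈ anchors s h
    · simp [hα, map_prod, MvPolynomial.map_X, MvPolynomial.map_C]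
    · simp [hα, MvPolynomial.map_C]
  rw [prod_congr rfl key, prod_ite_mem, inter_eq_right.mpr (anchors_mono hss)]

/-- `κ_s (symbolicDet s' …) = symbolicDet s …` for `s ≤ s'`. -/
theorem kill_symbolicDet {s s' : ℕ} (hss : s ≤ s') (r : ℕ) (u w : Fin r → Finset (Fin h)) :
    (bind₁ (Sum.elim (fun α => if α ∈ anchors s h then X (Sum.inl α) else 0)
        (fun q => X (Sum.inr q)) : Param h → MvPolynomial (Param h) ℂ)).toRingHom
      (symbolicDet s' h r u w) = symbolicDet s h r u w := by
  unfold symbolicDet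
  rw [RingHom.map_det]
  congr 1
  ext i j
  simp only [RingHom.mapMatrix_apply, Matrix.map_apply, Matrix.of_apply]
  rw [← MvPolynomial.coeff_map, map_kill_symbolicWitness hss]

/-- **Monotonicity in the profile bound.** A nonzero symbolic minor for 𝔄_s stays nonzero for every 𝔄_{s'}, `s' ≥ s`. -/
theorem symbolicDet_ne_zero_mono {s s' : ℕ} (hss : s ≤ s') {r : ℕ} {u w : Fin r → Finset (Fin h)}
    (hs : symbolicDet s h r u w ≠ 0) : symbolicDet s' h r u w ≠ 0 := by
  intro h0
  apply hs
  rw [← kill_symbolicDet hss r u w, h0, map_zero]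

/-- The line's stub `Stmt.stub_symbolicNonvanishing` at profile `s` follows from the same statement at any smaller profile
`s₀ ≤ s` (same `h₀`): a proof or certificate for 𝔄_{s₀} serves every 𝔄_s. -/
theorem stub_symbolicNonvanishing_of_profile (s₀ h₀ : ℕ)
    (H : ∀ h : ℕ, h₀ ≤ h → ∀ (r : ℕ) (u w : Fin r → Finset (Fin h)),
      Function.Injective u → Function.Injective w →
      IsLowerSet (Set.range u) → IsLowerSet (Set.range w) → symbolicDet s₀ h r u w ≠ 0)
    {s : ℕ} (hs : s₀ ≤ s) : ∀ h : ℕ, h₀ ≤ h → ∀ (r : ℕ) (u w : Fin r → Finset (Fin h)),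
      Function.Injective u → Function.Injective w →
      IsLowerSet (Set.range u) → IsLowerSet (Set.range w) → symbolicDet s h r u w ≠ 0 :=
  fun h hh r u w hu hw hlu hlw => symbolicDet_ne_zero_mono hs (H h hh r u w hu hw hlu hlw)

end

end Summit.ValiantsHypothesis.ValiantsHypothesis.Theorems.BarrierLever.AnchoredPeeling
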